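import Summits.QuantumFields.YangMills.Theorems.BalabanLadderNTClassicalShadowThreeValley
import HarnessLib

/-!
# Crux `NT` (stmt-QuantumFields-19353), stub `stub_refpkgT : RefPkgT`: THE CLASSICAL SHADOW, V — the ORBIT test: clauses 1–3 price a
# degenerate ground state that is ONE orbit of a finite symmetry group by the orbit statistics of the corner density

Helper file (`--supports stmt-QuantumFields-19353`) of the fleet lead prover of crux `NT` (unit `ym-spine-19353-p1`, GEN 14); sequel
of `…NTClassicalShadow{,TwoValley,TwoValleyPerm,ThreeValley}` (p598990, p599572, p600244, p600646).

WHY.  The two/three-valley files priced ground states broken under ONE coordinate permutation, acting on the corner density by a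
site map (`dens_perm`).  The symmetric frustrated boxes of the classical programme (this seat's kit jobs j298039/j298040/j298223:
coherent abelian / self-dual / non-abelian flux exteriors in `b⁴` boxes, `SU(2)`) have LARGER symmetry groups — axis REFLECTIONS
as well as permutations — and their Wilson-action minimisers are found numerically to form whole orbits of such groups.  A
reflection does not act on the corner-based density by a site map (the plaquette based at `x` goes to a plaquette based at a
shifted mirror site, orientation by orientation), so the honest statement is abstract: a finite family of maps
`γ i : LGConfig → LGConfig` (`i : ι`) under which the KERNEL is invariant, and ground states on which the `γ`-AVERAGES of the
relevant observables are constant (automatic when the ground-state set is one `γ`-orbit).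

* §1 `kerE_fintype_sum` (linearity over finite sums), **`tendsto_kerE_of_orbit`** — if `Σᵢ F ∘ γ i` is constant `= M` on the ground
  states of `η` and `kerE^η_β(F ∘ γ i) = kerE^η_β(F)` for all `i, β`, then `kerE^η_β(F) → M / |ι|` (Laplace step on the orbit average);
* §2 **`tendsto_kerCov_of_orbit`** — `kerCov^η_β(dens_x, dens_y) → M₁₂/k − (M₁/k)(M₂/k)` (`k = |ι|`; `M₁, M₂, M₁₂` the ground-state
  values of the orbit sums of `dens_x`, `dens_y`, `dens_x·dens_y`): the zero-temperature conditional covariance of a one-orbit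
  degenerate box IS the orbit covariance of the classical density field — whatever the (symmetric) zero-temperature law;
* §3 the prices: **`orbitCov_le_of_e2osc`** — clause 2 ⇒ `|M₁₂/k − M₁M₂/k²| ≤ C₂/min(d_x,d_y)⁴/(1+‖y−x‖)⁴` (depths `≥ 2`);
  **`orbitMean_deficit_le_of_e1osc`** — clause 1 ⇒ `6N − M₁/k ≤ C₁/d_x⁴` (the orbit-MEAN deficit, sharper than the max-over-ground-states
  form of `exists_groundState_dens_ge_of_e1osc` when the ground states are one orbit); `orbitVar_le_of_e2osc` (`x = y`:
  the orbit VARIANCE of the density at a deep site is `≤ C₂/d⁴`).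

So every symmetric frustrated box whose classical ground states form one orbit `{γ i · A}` yields β-free, ε-free floors
`C₁ ≥ d⁴·(6N − mean_i dens_x(γ i A))`, `C₂ ≥ d⁴(1+n)⁴·|Cov_i(dens_x(γ i A), dens_y(γ i A))|`, `C₂ ≥ d⁴·Var_i(dens_x(γ i A))`, computable
from ONE minimiser `A` and the group — the numbers of memo SIZING-19353-g14 §2.

HONEST FRAMING.  Consequences of the registered clauses at fixed lattice geometry as `β → ∞`; the kernel symmetry under `γ` and the
one-orbit structure are HYPOTHESES (supplied by the tree for coordinate permutations, `kerE_perm_symm_fun`; for axis reflections a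
covariance lemma for `ymSpecification` under orientation-reversing relabellings is wanted); nothing here asserts that such an exterior
exists; no floor, not AF, not NT, not the seam, not the gap; not Clay.
-/

set_option autoImplicit false

noncomputable section

open MeasureTheory Filter Topology
open Literature.MathematicalPhysics.QuantumFieldTheory Literature.MathematicalPhysics.QuantumLattice
open Literature.Probability.LatticeModels
open Summit.QuantumFields.YangMills.Cruxes.OSLegsFromFemtoAndGap.DlrCollarTransfer
open Summit.QuantumFields.YangMills.Cruxes.UVSeamRec.BoundaryLawPenetration
open Summit.QuantumFields.YangMills.Theorems.OSLegsFromFemtoAndGap.StubLower (integrable_of_continuous_compact)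

namespace Summit.QuantumFields.YangMills.Cruxes.NT.ClassicalShadow

variable {G : Type} [Group G] [TopologicalSpace G] [IsTopologicalGroup G] [CompactSpace G]
  [MeasurableSpace G] [BorelSpace G] (r : LatticeRep G)

/-! ## §1 The orbit average and its zero-temperature kernel mean -/

section Orbit

variable (c : Fin 4 → ℤ) (b : ℕ) (η : LGConfig 4 G) {ι : Type} [Fintype ι]

/-- Linearity of the cube kernel over finite sums of continuous observables. [folklore] -/
theorem kerE_fintype_sum (β : ℝ) (F : ι → LGConfig 4 G → ℝ) (hF : ∀ i, Continuous (F i)) :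
    kerE G r β c b η (fun U => ∑ i, F i U) = ∑ i, kerE G r β c b η (F i) := by
  haveI : SecondCountableTopology G := (Continuous.isClosedEmbedding r.continuous r.injective).isEmbedding.secondCountableTopology
  haveI := isProbabilityMeasure_ymSpecification r.ρ r.continuous β (cubeEdges c b) η
  unfold kerE
  rw [integral_finsetSum Finset.univ (fun i _ => integrable_of_continuous_compact (hF i))]

/-- **The zero-temperature kernel mean on a symmetric orbit.**  Let `γ i` (`i : ι`, finite, non-empty) be maps of the configuration
space with `F ∘ γ i` continuous, under which the kernel of `(c, b, η)` is invariant on `F` (`kerE^η_β(F ∘ γ i) = kerE^η_β(F)`), and suppose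
the orbit sum `Σᵢ F ∘ γ i` is constant `= M` on the ground states.  Then `kerE^η_β(F) → M / |ι|`. [folklore] -/
theorem tendsto_kerE_of_orbit [Nonempty ι] (γ : ι → LGConfig 4 G → LGConfig 4 G) {F : LGConfig 4 G → ℝ}
    (hFγ : ∀ i, Continuous (F ∘ γ i)) {M : ℝ}
    (hM : ∀ ζ ∈ cubeMinimisers G r c b η, ∑ i, F (γ i (glueWith (cubeEdges c b) ζ η)) = M)
    (hsymm : ∀ (β : ℝ) (i : ι), kerE G r β c b η (F ∘ γ i) = kerE G r β c b η F) :
    Tendsto (fun β : ℝ => kerE G r β c b η F) atTop (𝓝 (M / Fintype.card ι)) := by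
  have hk : (0 : ℝ) < Fintype.card ι := Nat.cast_pos.2 Fintype.card_pos
  have h : Tendsto (fun β : ℝ => kerE G r β c b η (fun U => ∑ i, (F ∘ γ i) U)) atTop (𝓝 M) :=
    tendsto_kerE_of_eq_on_cubeMinimisers r c b η (continuous_finsetSum Finset.univ fun i _ => hFγ i)
      (fun ζ hζ => by simpa only [Function.comp_apply] using hM ζ hζ)
  have e : ∀ β : ℝ, kerE G r β c b η F = kerE G r β c b η (fun U => ∑ i, (F ∘ γ i) U) / Fintype.card ι := fun β => by
    rw [kerE_fintype_sum r c b η β (fun i => F ∘ γ i) hFγ]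
    simp only [hsymm β, Finset.sum_const, Finset.card_univ, nsmul_eq_mul]
    field_simp
  simp_rw [e]
  exact h.div_const _

/-! ## §2 The conditional covariance of a one-orbit degenerate box -/

/-- **Orbit test, two-point.**  With kernel symmetry under the `γ i` for `dens_x`, `dens_y`, `dens_x·dens_y` and the orbit sums of these
three observables constant `M₁, M₂, M₁₂` on the ground states:
`kerCov^η_β(dens_x, dens_y) → M₁₂/k − (M₁/k)(M₂/k)`, `k = |ι|`. [folklore] -/
theorem tendsto_kerCov_of_orbit [Nonempty ι] (γ : ι → LGConfig 4 G → LGConfig 4 G) (hγ : ∀ i, Continuous (γ i))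
    {x y : Fin 4 → ℤ} {M₁ M₂ M₁₂ : ℝ}
    (h₁ : ∀ ζ ∈ cubeMinimisers G r c b η, ∑ i, dens G r x (γ i (glueWith (cubeEdges c b) ζ η)) = M₁)
    (h₂ : ∀ ζ ∈ cubeMinimisers G r c b η, ∑ i, dens G r y (γ i (glueWith (cubeEdges c b) ζ η)) = M₂)
    (h₁₂ : ∀ ζ ∈ cubeMinimisers G r c b η,
      ∑ i, dens G r x (γ i (glueWith (cubeEdges c b) ζ η)) * dens G r y (γ i (glueWith (cubeEdges c b) ζ η)) = M₁₂)
    (s₁ : ∀ (β : ℝ) (i : ι), kerE G r β c b η (dens G r x ∘ γ i) = kerE G r β c b η (dens G r x))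
    (s₂ : ∀ (β : ℝ) (i : ι), kerE G r β c b η (dens G r y ∘ γ i) = kerE G r β c b η (dens G r y))
    (s₁₂ : ∀ (β : ℝ) (i : ι), kerE G r β c b η ((fun U => dens G r x U * dens G r y U) ∘ γ i) =
      kerE G r β c b η (fun U => dens G r x U * dens G r y U)) :
    Tendsto (fun β : ℝ => kerCov G r β c b η (dens G r x) (dens G r y)) atTop
      (𝓝 (M₁₂ / Fintype.card ι - M₁ / Fintype.card ι * (M₂ / Fintype.card ι))) := by
  have hX := tendsto_kerE_of_orbit r c b η γ (fun i => (continuous_dens r x).comp (hγ i)) h₁ s₁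
  have hY := tendsto_kerE_of_orbit r c b η γ (fun i => (continuous_dens r y).comp (hγ i)) h₂ s₂
  have hXY := tendsto_kerE_of_orbit r c b η γ (F := fun U => dens G r x U * dens G r y U)
    (fun i => ((continuous_dens r x).mul (continuous_dens r y)).comp (hγ i)) h₁₂ s₁₂
  exact hXY.sub (hX.mul hY)

end Orbit

/-! ## §3 The prices -/

section Price

variable (a : ℝ → ℝ) {ι : Type} [Fintype ι] [Nonempty ι]

/-- **Clause 2 prices a one-orbit degenerate box by the orbit covariance of its density field**:
`|M₁₂/k − (M₁/k)(M₂/k)| ≤ C₂ / min(d_x,d_y)⁴ / (1 + ‖y − x‖)⁴`. [folklore] -/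
theorem orbitCov_le_of_e2osc (ha0 : Tendsto a atTop (𝓝 0)) {C₂ ℓ : ℝ} (hℓ : 0 < ℓ)
    (hE2 : ∃ β₂ : ℝ, ∀ β : ℝ, β₂ ≤ β → ∀ (c : Fin 4 → ℤ) (b : ℕ), (b : ℝ) * a β ≤ ℓ →
      ∀ (η η' : LGConfig 4 G) (x y : Fin 4 → ℤ), 1 ≤ depth c b x → 1 ≤ depth c b y →
        |kerCov G r β c b η (dens G r x) (dens G r y) - kerCov G r β c b η' (dens G r x) (dens G r y)| ≤
          C₂ / ((min (depth c b x) (depth c b y) : ℕ) : ℝ) ^ 4 / (1 + ‖siteToE (y - x)‖) ^ 4)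
    (c : Fin 4 → ℤ) (b : ℕ) (η : LGConfig 4 G) (γ : ι → LGConfig 4 G → LGConfig 4 G) (hγ : ∀ i, Continuous (γ i))
    {x y : Fin 4 → ℤ} (hx : 2 ≤ depth c b x) (hy : 2 ≤ depth c b y) {M₁ M₂ M₁₂ : ℝ}
    (h₁ : ∀ ζ ∈ cubeMinimisers G r c b η, ∑ i, dens G r x (γ i (glueWith (cubeEdges c b) ζ η)) = M₁)
    (h₂ : ∀ ζ ∈ cubeMinimisers G r c b η, ∑ i, dens G r y (γ i (glueWith (cubeEdges c b) ζ η)) = M₂)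
    (h₁₂ : ∀ ζ ∈ cubeMinimisers G r c b η,
      ∑ i, dens G r x (γ i (glueWith (cubeEdges c b) ζ η)) * dens G r y (γ i (glueWith (cubeEdges c b) ζ η)) = M₁₂)
    (s₁ : ∀ (β : ℝ) (i : ι), kerE G r β c b η (dens G r x ∘ γ i) = kerE G r β c b η (dens G r x))
    (s₂ : ∀ (β : ℝ) (i : ι), kerE G r β c b η (dens G r y ∘ γ i) = kerE G r β c b η (dens G r y))
    (s₁₂ : ∀ (β : ℝ) (i : ι), kerE G r β c b η ((fun U => dens G r x U * dens G r y U) ∘ γ i) =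
      kerE G r β c b η (fun U => dens G r x U * dens G r y U)) :
    |M₁₂ / Fintype.card ι - M₁ / Fintype.card ι * (M₂ / Fintype.card ι)| ≤
      C₂ / ((min (depth c b x) (depth c b y) : ℕ) : ℝ) ^ 4 / (1 + ‖siteToE (y - x)‖) ^ 4 := by
  obtain ⟨β₂, H2⟩ := hE2
  have hlim : Tendsto (fun β : ℝ => |kerCov G r β c b η (dens G r x) (dens G r y) - kerCov G r β c b 1 (dens G r x) (dens G r y)|)
      atTop (𝓝 |M₁₂ / Fintype.card ι - M₁ / Fintype.card ι * (M₂ / Fintype.card ι)|) := by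
    have h := ((tendsto_kerCov_of_orbit r c b η γ hγ h₁ h₂ h₁₂ s₁ s₂ s₁₂).sub (tendsto_kerCov_one_dens r c b hx hy)).abs
    rwa [sub_zero] at h
  refine le_of_tendsto hlim ?_
  filter_upwards [eventually_mul_le_of_tendsto_zero ha0 hℓ b, eventually_ge_atTop β₂] with β hb hβ2
  exact H2 β hβ2 c b hb η 1 x y (le_trans one_le_two hx) (le_trans one_le_two hy)

/-- **Clause 2, diagonal: the orbit VARIANCE of the density at a deep site is `≤ C₂/d⁴`**:
`M₁₁/k − (M₁/k)² ≤ C₂/d_x⁴`. [folklore] -/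
theorem orbitVar_le_of_e2osc (ha0 : Tendsto a atTop (𝓝 0)) {C₂ ℓ : ℝ} (hℓ : 0 < ℓ)
    (hE2 : ∃ β₂ : ℝ, ∀ β : ℝ, β₂ ≤ β → ∀ (c : Fin 4 → ℤ) (b : ℕ), (b : ℝ) * a β ≤ ℓ →
      ∀ (η η' : LGConfig 4 G) (x y : Fin 4 → ℤ), 1 ≤ depth c b x → 1 ≤ depth c b y →
        |kerCov G r β c b η (dens G r x) (dens G r y) - kerCov G r β c b η' (dens G r x) (dens G r y)| ≤
          C₂ / ((min (depth c b x) (depth c b y) : ℕ) : ℝ) ^ 4 / (1 + ‖siteToE (y - x)‖) ^ 4)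
    (c : Fin 4 → ℤ) (b : ℕ) (η : LGConfig 4 G) (γ : ι → LGConfig 4 G → LGConfig 4 G) (hγ : ∀ i, Continuous (γ i))
    {x : Fin 4 → ℤ} (hx : 2 ≤ depth c b x) {M₁ M₁₁ : ℝ}
    (h₁ : ∀ ζ ∈ cubeMinimisers G r c b η, ∑ i, dens G r x (γ i (glueWith (cubeEdges c b) ζ η)) = M₁)
    (h₁₁ : ∀ ζ ∈ cubeMinimisers G r c b η,
      ∑ i, dens G r x (γ i (glueWith (cubeEdges c b) ζ η)) * dens G r x (γ i (glueWith (cubeEdges c b) ζ η)) = M₁₁)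
    (s₁ : ∀ (β : ℝ) (i : ι), kerE G r β c b η (dens G r x ∘ γ i) = kerE G r β c b η (dens G r x))
    (s₁₁ : ∀ (β : ℝ) (i : ι), kerE G r β c b η ((fun U => dens G r x U * dens G r x U) ∘ γ i) =
      kerE G r β c b η (fun U => dens G r x U * dens G r x U)) :
    M₁₁ / Fintype.card ι - (M₁ / Fintype.card ι) ^ 2 ≤ C₂ / (depth c b x : ℝ) ^ 4 := by
  have h := orbitCov_le_of_e2osc r a ha0 hℓ hE2 c b η γ hγ hx hx h₁ h₁ h₁₁ s₁ s₁ s₁₁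
  have h0 : ‖siteToE (x - x)‖ = 0 := by
    rw [sub_self, show siteToE (0 : Site 4) = 0 from by ext j; simp [siteToE_apply], norm_zero]
  rw [min_self, h0, add_zero, one_pow, div_one] at h
  rw [sq]
  exact (le_abs_self _).trans h

/-- **Clause 1 prices a one-orbit degenerate box by the orbit-MEAN deficit**: `6N − M₁/k ≤ C₁/d_x⁴`. [folklore] -/
theorem orbitMean_deficit_le_of_e1osc (ha0 : Tendsto a atTop (𝓝 0)) {C₁ ℓ : ℝ} (hℓ : 0 < ℓ)
    (hE1 : ∃ β₁ : ℝ, ∀ β : ℝ, β₁ ≤ β → ∀ (c : Fin 4 → ℤ) (b : ℕ), (b : ℝ) * a β ≤ ℓ →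
      ∀ (η η' : LGConfig 4 G) (x : Fin 4 → ℤ), 1 ≤ depth c b x →
        |kerE G r β c b η (dens G r x) - kerE G r β c b η' (dens G r x)| ≤ C₁ / (depth c b x : ℝ) ^ 4)
    (c : Fin 4 → ℤ) (b : ℕ) (η : LGConfig 4 G) (γ : ι → LGConfig 4 G → LGConfig 4 G) (hγ : ∀ i, Continuous (γ i))
    {x : Fin 4 → ℤ} (hx : 2 ≤ depth c b x) {M₁ : ℝ}
    (h₁ : ∀ ζ ∈ cubeMinimisers G r c b η, ∑ i, dens G r x (γ i (glueWith (cubeEdges c b) ζ η)) = M₁)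
    (s₁ : ∀ (β : ℝ) (i : ι), kerE G r β c b η (dens G r x ∘ γ i) = kerE G r β c b η (dens G r x)) :
    6 * (r.N : ℝ) - M₁ / Fintype.card ι ≤ C₁ / (depth c b x : ℝ) ^ 4 := by
  obtain ⟨β₁, H1⟩ := hE1
  have hlim : Tendsto (fun β : ℝ => kerE G r β c b 1 (dens G r x) - kerE G r β c b η (dens G r x)) atTop
      (𝓝 (6 * (r.N : ℝ) - M₁ / Fintype.card ι)) :=
    (tendsto_kerE_one_dens r c b hx).sub (tendsto_kerE_of_orbit r c b η γ (fun i => (continuous_dens r x).comp (hγ i)) h₁ s₁)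
  refine le_of_tendsto hlim ?_
  filter_upwards [eventually_mul_le_of_tendsto_zero ha0 hℓ b, eventually_ge_atTop β₁] with β hb hβ1
  exact (le_abs_self _).trans (H1 β hβ1 c b hb 1 η x (le_trans one_le_two hx))

end Price

end Summit.QuantumFields.YangMills.Cruxes.NT.ClassicalShadow

end
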